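import Mathlib
import Literature.NumberTheory.Irrationality.Calegari2005ThreeAdic.LinearFormsT
import Literature.NumberTheory.Irrationality.PAdicZetaValues.VolkenbornSecondDifference
import HarnessLib

/-!
# Towards Calegari's `ζ₃(3) ∉ ℚ` by Lai's Volkenborn method at `p = 3`, file 3: the exact `3`-adic valuation of
# `T_n` along `n = 3^m − 1`, hence `T_n ≠ 0` (Lai's Lemma 6.3 transposed, via the odd-`p` second-order estimate)

Topic `Literature/NumberTheory/Irrationality/Calegari2005ThreeAdic`.  TARGET of the folder: `PAdicZetaValues.calegari2005_theorem34`
([Calegari2005, Thm 3.4]; [Beukers2008, Cor. 23]).  ROAD (HONEST LABEL — an ADAPTATION, not a printed proof):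
[Lai2025TwoAdicZeta, Lemma 6.3] («`v₂(d_n^{2s+3}T_n) = …`, in particular `T_n ≠ 0`», `n = 2^m − 1`) transposed to
`p = 3`, `n = 3^m − 1`.  The one NEW ingredient w.r.t. `p = 2`: Lai's Lemma 2.5 (3) (the extra unit of precision for
`f^p = f²` at `p = 2`) is replaced by the odd-`p` second-order form of (2.3), tree
`PAdicZetaValues.norm_eq_norm_volkenbornSum_of_lipNatTwo` (`VolkenbornSecondDifference.lean`): for `3 ≠ 2`,
`‖∫F − 3^{−m}Σ_{k<3^m}F(k)‖₃ ≤ max(M, 3·M₂·3^{−m})`, with `M = 3^{m−1}` (Lemma 2.6 (e)) and `M₂ = 3^{2m−2}` (its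
second-order analogue `lipNatTwo_choose`), which is `< 3^m = ‖3^{−m}Σ_{k<3^m}F(k)‖₃` (the `k = 0` term is a unit,
the others are divisible by `9` by Kummer's theorem).

## What is formalised (all PROVED; `p = 3`, `s = 0`)

* `Fq n j = binom(j+n,n)²·g(j)²`, `g(j) = ∏_{i≤n}(3j+3i+1)^{−1}`, `cstB n = 3^{2(n+⌊n/2⌋)+2n+2}(n!)²`, `DB_natCast_eq`:
  `B_n(j+⅓) = cstB n · Fq n j`; the first- and second-order Lipschitz data of `Fq` (`lipNat_Fq`, `lipNatTwo_Fq`).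
* Along `n = 3^m − 1` (`m ≥ 1`): `three_dvd_choose_add` (Kummer), `norm_sum_Fq_eq_one`, and
  **`norm_T_pow_three_sub_one`: `‖T_n‖₃ = ‖cstB n‖₃·3^m`**, `T_pow_three_sub_one_ne_zero` (**`T_n ≠ 0`**),
  `norm_T_pow_three_sub_one_le` (`‖T_n‖₃ ≤ 3^{3m − 5n − 2⌊n/2⌋ − 2}`, Legendre `2v₃(n!) ≥ n − 2m`).

Cell zeta5-irr / pub-zeta5 (HONEST FRAMING: systematic search; no irrationality claim unless kernel-certified):
`3`-adic valuation of linear forms in `1, ζ₃(3)`; nothing here bears on `ζ(5) ∈ ℝ`.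
-/

noncomputable section

open Finset Filter Topology
open Literature.NumberTheory.LocalFields
open Literature.NumberTheory.Irrationality.PAdicZetaValues
open scoped Nat

namespace Literature.NumberTheory.Irrationality.Calegari2005ThreeAdic

/-! ## §1. The integrand at the naturals: `B_n(j+⅓) = cstB n · binom(j+n,n)² · g(j)²` -/

/-- `g(j) := ∏_{i ≤ n} (3j + 3i + 1)⁻¹`. [cite: Lai2025TwoAdicZeta, Lemma 6.3 (proof: g(t) = ∏(4t+4k+1)^{−(s+2)}) — transposed to p = 3] -/
def gq (n j : ℕ) : ℚ_[3] := ∏ i ∈ range (n + 1), ((3 : ℚ_[3]) * j + ((3 * i + 1 : ℕ) : ℚ_[3]))⁻¹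

/-- `binom(j+n, n)` in `ℚ₃`. [cite: Lai2025TwoAdicZeta, Lemma 6.3 (proof: (t+1)⋯(t+n) = n!·binom(t+n,n)) — transposed to p = 3] -/
def Cq (n j : ℕ) : ℚ_[3] := (((j + n).choose n : ℕ) : ℚ_[3])

/-- `F(j) := binom(j+n,n)²·g(j)²`. [cite: Lai2025TwoAdicZeta, Lemma 6.3 (proof: f_{(0,…,0)}) — transposed to p = 3] -/
def Fq (n j : ℕ) : ℚ_[3] := Cq n j ^ 2 * gq n j ^ 2

/-- The constant `3^{2(n+⌊n/2⌋)+2n+2}·(n!)²`. [cite: Lai2025TwoAdicZeta, Lemma 6.3 (proof: B_n(t+¼) = 2^{(5s+10)n+2s+4}f(t)) — transposed to p = 3] -/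
def cstB (n : ℕ) : ℚ_[3] := (3 : ℚ_[3]) ^ (2 * (n + n / 2) + (2 * n + 2)) * (((n ! : ℕ) : ℚ_[3])) ^ 2

/-- `cstB n ≠ 0`. [cite: Lai2025TwoAdicZeta, Lemma 6.3 (proof: the nonzero prefactor 2^{(5s+10)n+2s+4}n!^{s+2}) — transposed to p = 3] -/
theorem cstB_ne_zero (n : ℕ) : cstB n ≠ 0 := by
  unfold cstB
  exact mul_ne_zero (pow_ne_zero _ (by norm_num)) (pow_ne_zero _ (by exact_mod_cast Nat.factorial_ne_zero n))

/-- The factors `3j + 3i + 1` are `3`-adic units. [folklore] -/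
private theorem norm_factor (j i : ℕ) : ‖((3 : ℚ_[3]) * j + ((3 * i + 1 : ℕ) : ℚ_[3]))‖ = 1 := by
  have e : ((3 : ℚ_[3]) * j + ((3 * i + 1 : ℕ) : ℚ_[3])) = (((3 * j + 3 * i + 1 : ℕ)) : ℚ_[3]) := by push_cast; ring
  rw [e]
  exact norm_natCast_of_not_dvd (p := 3) (by omega)

/-- **`B_n(j+⅓) = cstB n · binom(j+n,n)² · g(j)²`** at every natural `j` (tree form of `RationalFunctionB.B_natCast_add_third`).
[cite: Lai2025TwoAdicZeta, Lemma 6.3 (proof: the displays for B_n(t+¼), f, g) — transposed to p = 3] -/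
theorem DB_natCast_eq (n j : ℕ) : DB n (j : ℤ_[3]) = cstB n * Fq n j := by
  rw [DB_natCast, DBq_natCast_eq_B, B_natCast_add_third]
  have hP : ∏ i ∈ range (n + 1), ((3 : ℚ_[3]) * j + ((3 * i + 1 : ℕ) : ℚ_[3])) ≠ 0 := by
    refine prod_ne_zero_iff.2 fun i _ => ?_
    intro h0; have h1 := norm_factor j i; rw [h0, norm_zero] at h1; exact zero_ne_one h1
  rw [Fq, Cq, gq, cstB, prod_inv_distrib]
  push_cast
  have e2 : ∏ i ∈ range (n + 1), (3 * (j : ℚ_[3]) + 3 * (i : ℚ_[3]) + 1) =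
      ∏ i ∈ range (n + 1), ((3 : ℚ_[3]) * j + (3 * (i : ℚ_[3]) + 1)) := prod_congr rfl fun i _ => by ring
  rw [e2]
  have hP' : ∏ i ∈ range (n + 1), ((3 : ℚ_[3]) * j + (3 * (i : ℚ_[3]) + 1)) ≠ 0 := by
    convert hP using 2
    push_cast; rfl
  field_simp

/-! ### The first- and second-order Lipschitz data of `g`, `binom(·+n,n)` and `F` -/

/-- `‖3‖₃ = ⅓`. [folklore] -/
private theorem norm_three : ‖(3 : ℚ_[3])‖ = 3⁻¹ := by simpa using Padic.norm_p (p := 3)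

/-- Each factor `(3j + 3i + 1)^{−1}` of `g`: `ℤ₃`-valued, Lipschitz constant `‖3‖₃`, second-difference constant `‖3‖₃²`.
[cite: LaiSprangZudilin2026, Lemma 2.6 (d) (here the explicit case (at+b)^{−1})] -/
theorem lip_gq_factor (i : ℕ) :
    LipNat 3 ‖(3 : ℚ_[3])‖ (fun j : ℕ => ((3 : ℚ_[3]) * j + ((3 * i + 1 : ℕ) : ℚ_[3]))⁻¹) ∧
      BddNat 3 (fun j : ℕ => ((3 : ℚ_[3]) * j + ((3 * i + 1 : ℕ) : ℚ_[3]))⁻¹) ∧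
      LipNatTwo 3 (‖(3 : ℚ_[3])‖ ^ 2) (fun j : ℕ => ((3 : ℚ_[3]) * j + ((3 * i + 1 : ℕ) : ℚ_[3]))⁻¹) := by
  have ha : ‖(3 : ℚ_[3])‖ < 1 := by rw [norm_three]; norm_num
  have hb : ‖((3 * i + 1 : ℕ) : ℚ_[3])‖ = 1 := norm_natCast_of_not_dvd (p := 3) (by omega)
  exact ⟨lipNat_inv_linear ha hb, bddNat_inv_linear ha hb, lipNatTwo_inv_linear ha hb⟩

/-- `g²`: `ℤ₃`-valued, Lipschitz constant `‖3‖₃`, second-difference constant `max(‖3‖₃², ‖3‖₃·‖3‖₃)`.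
[cite: LaiSprangZudilin2026, Lemma 2.6 (c)] -/
theorem lip_gq_sq (n : ℕ) :
    LipNat 3 ‖(3 : ℚ_[3])‖ (fun j => gq n j ^ 2) ∧ BddNat 3 (fun j => gq n j ^ 2) ∧
      LipNatTwo 3 (max (‖(3 : ℚ_[3])‖ ^ 2) (‖(3 : ℚ_[3])‖ * ‖(3 : ℚ_[3])‖)) (fun j => gq n j ^ 2) := by
  have h1 : LipNat 3 ‖(3 : ℚ_[3])‖ (gq n) :=
    LipNat.finset_prod (range (n + 1)) (norm_nonneg _) (fun i _ => (lip_gq_factor i).1) fun i _ => (lip_gq_factor i).2.1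
  have h2 : BddNat 3 (gq n) := BddNat.finset_prod (range (n + 1)) fun i _ => (lip_gq_factor i).2.1
  have h3 : LipNatTwo 3 (max (‖(3 : ℚ_[3])‖ ^ 2) (‖(3 : ℚ_[3])‖ * ‖(3 : ℚ_[3])‖)) (gq n) :=
    LipNatTwo.finset_prod (range (n + 1)) (norm_nonneg _) (by positivity)
      (fun i _ => ((lip_gq_factor i).2.2).mono (le_max_left _ _)) (fun i _ => (lip_gq_factor i).1)
      fun i _ => (lip_gq_factor i).2.1
  exact ⟨h1.pow h2 (norm_nonneg _) 2, h2.pow 2, h3.sq h1 h2 (norm_nonneg _)⟩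

/-- `binom(·+n,n)²`: `ℤ₃`-valued, Lipschitz constant `3^{⌊log₃ n⌋}` (Lemma 2.6 (e)), second-difference constant
`3^{2⌊log₃ n⌋}` (its second-order analogue). [cite: LaiSprangZudilin2026, Lemma 2.6 (e)] -/
theorem lip_Cq_sq (n : ℕ) :
    LipNat 3 ((3 : ℝ) ^ Nat.log 3 n) (fun j => Cq n j ^ 2) ∧ BddNat 3 (fun j => Cq n j ^ 2) ∧
      LipNatTwo 3 (max ((3 : ℝ) ^ (2 * Nat.log 3 n)) ((3 : ℝ) ^ Nat.log 3 n * (3 : ℝ) ^ Nat.log 3 n))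
        (fun j => Cq n j ^ 2) := by
  have hC : LipNat 3 ((3 : ℝ) ^ Nat.log 3 n) (Cq n) := lipNat_choose (p := 3) n n
  have hCb : BddNat 3 (Cq n) := BddNat.natCast (p := 3) fun j => (j + n).choose n
  have hC2 : LipNatTwo 3 (max ((3 : ℝ) ^ (2 * Nat.log 3 n)) ((3 : ℝ) ^ Nat.log 3 n * (3 : ℝ) ^ Nat.log 3 n)) (Cq n) :=
    (lipNatTwo_choose (p := 3) n n).mono (le_max_left _ _)
  exact ⟨hC.pow hCb (by positivity) 2, hCb.pow 2, hC2.sq hC hCb (by positivity)⟩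

/-- **The Lipschitz data of `F = binom(·+n,n)²·g²`** (Lemma 2.6 (c)): constants
`M = max(3^{⌊log₃ n⌋}, ‖3‖₃)` and `M₂ = max(max(M₂(binom²), M₂(g²)), 3^{⌊log₃ n⌋}·‖3‖₃)`. [cite: LaiSprangZudilin2026, Lemma 2.6 (c)] -/
theorem lip_Fq (n : ℕ) :
    LipNat 3 (max ((3 : ℝ) ^ Nat.log 3 n) ‖(3 : ℚ_[3])‖) (Fq n) ∧ BddNat 3 (Fq n) ∧
      LipNatTwo 3 (max (max (max ((3 : ℝ) ^ (2 * Nat.log 3 n)) ((3 : ℝ) ^ Nat.log 3 n * (3 : ℝ) ^ Nat.log 3 n))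
        (max (‖(3 : ℚ_[3])‖ ^ 2) (‖(3 : ℚ_[3])‖ * ‖(3 : ℚ_[3])‖))) ((3 : ℝ) ^ Nat.log 3 n * ‖(3 : ℚ_[3])‖)) (Fq n) := by
  obtain ⟨hC1, hCb, hC2⟩ := lip_Cq_sq n
  obtain ⟨hg1, hgb, hg2⟩ := lip_gq_sq n
  exact ⟨hC1.mul hg1 hCb hgb, hCb.mul hgb, hC2.mul hg2 hC1 hg1 hCb hgb (by positivity)⟩

/-! ## §2. Along `n = 3^m − 1`: the Riemann sum at level `m` is a unit times `3^m` -/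

/-- **Kummer at the `m`-th ternary digit:** for `1 ≤ k < 3^m`, `3 ∣ binom(k + 3^m − 1, 3^m − 1)` (adding `k` and
`3^m − 1 = 22⋯2₃` produces a carry out of the lowest `m` digits). [cite: Lai2025TwoAdicZeta, Lemma 6.3 (proof: "binom(k+2^m−1, 2^m−1) is even … by Kummer's or Lucas' theorem") — transposed to p = 3] -/
theorem three_dvd_choose_add {m k : ℕ} (hm : 1 ≤ m) (hk1 : 1 ≤ k) (hk : k < 3 ^ m) :
    3 ∣ (k + (3 ^ m - 1)).choose (3 ^ m - 1) := by
  haveI := Fact.mk Nat.prime_three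
  have h3m : 1 ≤ 3 ^ m := Nat.one_le_pow _ _ (by norm_num)
  set b := Nat.log 3 (k + (3 ^ m - 1)) + 1 with hb
  have hv := padicValNat_choose' (p := 3) (n := k) (k := 3 ^ m - 1) (b := b) (by omega)
  have hmem : m ∈ (Finset.Ico 1 b).filter (fun i => 3 ^ i ≤ (3 ^ m - 1) % 3 ^ i + k % 3 ^ i) := by
    rw [mem_filter, mem_Ico]
    refine ⟨⟨hm, ?_⟩, ?_⟩
    · rw [hb]
      exact Nat.lt_succ_of_le (Nat.le_log_of_pow_le (by norm_num) (by omega))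
    · rw [Nat.mod_eq_of_lt (by omega : 3 ^ m - 1 < 3 ^ m), Nat.mod_eq_of_lt hk]
      omega
  have hcard : 1 ≤ padicValNat 3 ((k + (3 ^ m - 1)).choose (3 ^ m - 1)) := by
    rw [hv]
    exact Finset.card_pos.2 ⟨m, hmem⟩
  exact dvd_of_one_le_padicValNat hcard

/-- `‖binom(k+n,n)‖₃ ≤ ⅓` for `1 ≤ k < 3^m`, `n = 3^m − 1`. [cite: Lai2025TwoAdicZeta, Lemma 6.3 (proof) — transposed to p = 3] -/
theorem norm_Cq_le_third {m k : ℕ} (hm : 1 ≤ m) (hk1 : 1 ≤ k) (hk : k < 3 ^ m) :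
    ‖Cq (3 ^ m - 1) k‖ ≤ 3⁻¹ := by
  have hlt : ‖Cq (3 ^ m - 1) k‖ < 1 := by
    rw [Cq, Padic.norm_natCast_lt_one_iff]
    exact three_dvd_choose_add hm hk1 hk
  have h := (Padic.norm_le_pow_iff_norm_lt_pow_add_one (Cq (3 ^ m - 1) k) (-1)).2 (by norm_num; exact hlt)
  have e : (((3 : ℕ) : ℝ)) ^ (-1 : ℤ) = 3⁻¹ := by norm_num
  rwa [e] at h

/-- `‖g(j)‖₃ = 1`. [cite: Lai2025TwoAdicZeta, Lemma 6.3 (proof: "g(0) ≡ 1") — transposed to p = 3] -/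
theorem norm_gq (n j : ℕ) : ‖gq n j‖ = 1 := by
  rw [gq, norm_prod]
  exact prod_eq_one fun i _ => by rw [norm_inv, norm_factor, inv_one]

/-- `‖F(0)‖₃ = 1`. [cite: Lai2025TwoAdicZeta, Lemma 6.3 (proof) — transposed to p = 3] -/
theorem norm_Fq_zero (n : ℕ) : ‖Fq n 0‖ = 1 := by
  rw [Fq, Cq, norm_mul, norm_pow, norm_pow, norm_gq, zero_add, Nat.choose_self, Nat.cast_one, norm_one, one_pow,
    mul_one]

/-- `‖F(k)‖₃ ≤ 1/9` for `1 ≤ k < 3^m`, `n = 3^m − 1`. [cite: Lai2025TwoAdicZeta, Lemma 6.3 (proof) — transposed to p = 3] -/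
theorem norm_Fq_le {m k : ℕ} (hm : 1 ≤ m) (hk1 : 1 ≤ k) (hk : k < 3 ^ m) : ‖Fq (3 ^ m - 1) k‖ ≤ 9⁻¹ := by
  rw [Fq, norm_mul, norm_pow, norm_pow, norm_gq, one_pow, mul_one]
  calc ‖Cq (3 ^ m - 1) k‖ ^ 2 ≤ (3⁻¹ : ℝ) ^ 2 := pow_le_pow_left₀ (norm_nonneg _) (norm_Cq_le_third hm hk1 hk) 2
    _ = 9⁻¹ := by norm_num

/-- **`‖Σ_{k<3^m} F(k)‖₃ = 1`** (`n = 3^m − 1`): the `k = 0` term is a unit, the others have norm `≤ 1/9`.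
[cite: Lai2025TwoAdicZeta, Lemma 6.3 (proof of (eqn_5_1)) — transposed to p = 3] -/
theorem norm_sum_Fq_eq_one {m : ℕ} (hm : 1 ≤ m) : ‖∑ k ∈ range (3 ^ m), Fq (3 ^ m - 1) k‖ = 1 := by
  have h3m : 1 ≤ 3 ^ m := Nat.one_le_pow _ _ (by norm_num)
  rw [← Finset.sum_range_add_sum_Ico _ h3m, Finset.sum_range_one]
  have hrest : ‖∑ k ∈ Ico 1 (3 ^ m), Fq (3 ^ m - 1) k‖ ≤ 9⁻¹ := by
    refine IsUltrametricDist.norm_sum_le_of_forall_le_of_nonneg (by norm_num) fun k hk => ?_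
    have hk' := mem_Ico.1 hk
    exact norm_Fq_le hm hk'.1 hk'.2
  have hne : ‖Fq (3 ^ m - 1) 0‖ ≠ ‖∑ k ∈ Ico 1 (3 ^ m), Fq (3 ^ m - 1) k‖ := by
    rw [norm_Fq_zero]; exact ne_of_gt (hrest.trans_lt (by norm_num))
  rw [Padic.add_eq_max_of_ne hne, norm_Fq_zero, max_eq_left (hrest.trans (by norm_num))]

/-! ## §3. `‖T_n‖₃ = ‖cstB n‖₃·3^m` for `n = 3^m − 1`, so `T_n ≠ 0` -/

/-- The normalised integrand `F(t) := B_n(t+⅓)/cstB n` on `ℤ₃` (values `Fq n` at the naturals). [cite: Lai2025TwoAdicZeta, Lemma 6.3 (proof) — transposed to p = 3] -/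
def Fz (n : ℕ) (t : ℤ_[3]) : ℚ_[3] := (cstB n)⁻¹ * DB n t

/-- `Fz n j = Fq n j` at every natural `j`. [cite: Lai2025TwoAdicZeta, Lemma 6.3 (proof) — transposed to p = 3] -/
theorem Fz_natCast (n j : ℕ) : Fz n (j : ℤ_[3]) = Fq n j := by
  rw [Fz, DB_natCast_eq, ← mul_assoc, inv_mul_cancel₀ (cstB_ne_zero n), one_mul]

/-- The Riemann sums of `Fz n` tend to `(cstB n)⁻¹·T_n`. [cite: Lai2025TwoAdicZeta, Definition 3.2 / Lemma 6.3 (proof) — transposed to p = 3] -/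
theorem tendsto_volkenbornSum_Fz (n : ℕ) : Tendsto (volkenbornSum 3 (Fz n)) atTop (𝓝 ((cstB n)⁻¹ * T n)) := by
  refine ((tendsto_volkenbornSum_DB_T n).const_mul (cstB n)⁻¹).congr fun N => ?_
  rw [← smul_eq_mul, ← volkenbornSum_smul]
  rfl

/-- The Riemann sum of `Fz n` at level `m` has norm `3^m` when `n = 3^m − 1`. [cite: Lai2025TwoAdicZeta, Lemma 6.3 (proof of (eqn_5_1)) — transposed to p = 3] -/
theorem norm_volkenbornSum_Fz {m : ℕ} (hm : 1 ≤ m) :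
    ‖volkenbornSum 3 (Fz (3 ^ m - 1)) m‖ = (3 : ℝ) ^ m := by
  rw [volkenbornSum_def, norm_smul, norm_inv, norm_pow, Padic.norm_p, inv_pow, inv_inv]
  have e : ∑ k ∈ range (3 ^ m), Fz (3 ^ m - 1) (k : ℤ_[3]) = ∑ k ∈ range (3 ^ m), Fq (3 ^ m - 1) k :=
    sum_congr rfl fun k _ => Fz_natCast _ k
  push_cast
  rw [e, norm_sum_Fq_eq_one hm, mul_one]

/-- `⌊log₃(3^m − 1)⌋ = m − 1` (`m ≥ 1`). [folklore] -/
private theorem log_three_pow_sub_one {m : ℕ} (hm : 1 ≤ m) : Nat.log 3 (3 ^ m - 1) = m - 1 := by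
  have h3m : 3 ≤ 3 ^ m := by
    calc (3 : ℕ) = 3 ^ 1 := by norm_num
      _ ≤ 3 ^ m := Nat.pow_le_pow_right (by norm_num) hm
  have hn0 : 3 ^ m - 1 ≠ 0 := by omega
  refine le_antisymm ?_ ?_
  · have := (Nat.log_lt_iff_lt_pow (by norm_num) hn0).2 (show 3 ^ m - 1 < 3 ^ m by omega); omega
  · refine Nat.le_log_of_pow_le (by norm_num) ?_
    have : 3 ^ m = 3 * 3 ^ (m - 1) := by rw [← pow_succ']; congr 1; omega
    omega

/-- **Lai's Lemma 6.3 at `p = 3`, `s = 0` (exact valuation):** for `n = 3^m − 1`, `m ≥ 1`, `‖T_n‖₃ = ‖cstB n‖₃·3^m`, i.e.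
`v₃(T_n) = 2(n+⌊n/2⌋) + 2n + 2 + 2v₃(n!) − m`.  Proof: `F|_ℕ` has Lipschitz constant `≤ 3^{m−1}` and second-difference
constant `≤ 3^{2m−2}`, so by the odd-`p` form of (2.3) `‖∫F − 3^{−m}Σ_{k<3^m}F(k)‖₃ ≤ 3^{m−1} < 3^m = ‖3^{−m}Σ_{k<3^m}F(k)‖₃`.
[cite: Lai2025TwoAdicZeta, Lemma 6.3 — transposed to p = 3] [cite: Robert2000PadicAnalysis, Ch. V §5.1 (second-order increments)] -/
theorem norm_T_pow_three_sub_one {m : ℕ} (hm : 1 ≤ m) :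
    ‖T (3 ^ m - 1)‖ = ‖cstB (3 ^ m - 1)‖ * (3 : ℝ) ^ m := by
  set n : ℕ := 3 ^ m - 1 with hn
  have hlog : Nat.log 3 n = m - 1 := log_three_pow_sub_one hm
  obtain ⟨hF1, -, hF2⟩ := lip_Fq n
  -- transport the clauses to `Fz`
  set M : ℝ := max ((3 : ℝ) ^ Nat.log 3 n) ‖(3 : ℚ_[3])‖ with hM
  set M₂ : ℝ := max (max (max ((3 : ℝ) ^ (2 * Nat.log 3 n)) ((3 : ℝ) ^ Nat.log 3 n * (3 : ℝ) ^ Nat.log 3 n))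
    (max (‖(3 : ℚ_[3])‖ ^ 2) (‖(3 : ℚ_[3])‖ * ‖(3 : ℚ_[3])‖))) ((3 : ℝ) ^ Nat.log 3 n * ‖(3 : ℚ_[3])‖) with hM₂
  have hM0 : 0 ≤ M := le_max_of_le_left (by positivity)
  have hM₂0 : 0 ≤ M₂ := le_max_of_le_right (by positivity)
  have hF1' : LipNat 3 M (fun k : ℕ => Fz n (k : ℤ_[3])) := by
    intro k h
    show ‖Fz n ((k + h : ℕ) : ℤ_[3]) - Fz n ((k : ℕ) : ℤ_[3])‖ ≤ M * ‖(h : ℚ_[3])‖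
    rw [Fz_natCast, Fz_natCast]; exact hF1 k h
  have hF2' : LipNatTwo 3 M₂ (fun k : ℕ => Fz n (k : ℤ_[3])) := by
    intro k h
    show ‖Fz n ((k + 2 * h : ℕ) : ℤ_[3]) - 2 * Fz n ((k + h : ℕ) : ℤ_[3]) + Fz n ((k : ℕ) : ℤ_[3])‖ ≤
      M₂ * ‖(h : ℚ_[3])‖ ^ 2
    rw [Fz_natCast, Fz_natCast, Fz_natCast]; exact hF2 k h
  -- the numerical bounds `M ≤ 3^{m−1}`, `3·M₂·3^{−m} ≤ 3^{m−1}`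
  have h3 : ‖(3 : ℚ_[3])‖ = 3⁻¹ := norm_three
  have hMle : M ≤ (3 : ℝ) ^ (m - 1) := by
    rw [hM, hlog, h3]
    refine max_le le_rfl ?_
    calc (3 : ℝ)⁻¹ ≤ 1 := by norm_num
      _ ≤ 3 ^ (m - 1) := one_le_pow₀ (by norm_num)
  have hM₂le : M₂ ≤ (3 : ℝ) ^ (2 * (m - 1)) := by
    have h1 : (1 : ℝ) ≤ 3 ^ (m - 1) := one_le_pow₀ (by norm_num)
    have hsq : (3 : ℝ) ^ (2 * (m - 1)) = 3 ^ (m - 1) * 3 ^ (m - 1) := by rw [two_mul, pow_add]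
    rw [hM₂, hlog, h3, hsq]
    refine max_le (max_le (max_le le_rfl le_rfl) (max_le ?_ ?_)) ?_
    · calc (3 : ℝ)⁻¹ ^ 2 ≤ 1 * 1 := by norm_num
        _ ≤ 3 ^ (m - 1) * 3 ^ (m - 1) := by gcongr
    · calc (3 : ℝ)⁻¹ * 3⁻¹ ≤ 1 * 1 := by norm_num
        _ ≤ 3 ^ (m - 1) * 3 ^ (m - 1) := by gcongr
    · calc (3 : ℝ) ^ (m - 1) * 3⁻¹ ≤ 3 ^ (m - 1) * 1 := by gcongr; norm_num
        _ ≤ 3 ^ (m - 1) * 3 ^ (m - 1) := by gcongr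
  have hI := tendsto_volkenbornSum_Fz n
  have hSm : ‖volkenbornSum 3 (Fz n) m‖ = (3 : ℝ) ^ m := norm_volkenbornSum_Fz hm
  have hbig : max M (3 * M₂ * (3 : ℝ) ^ (-(m : ℤ))) < ‖volkenbornSum 3 (Fz n) m‖ := by
    rw [hSm]
    have hlt : (3 : ℝ) ^ (m - 1) < 3 ^ m := pow_lt_pow_right₀ (by norm_num) (by omega)
    refine max_lt (hMle.trans_lt hlt) ?_
    calc 3 * M₂ * (3 : ℝ) ^ (-(m : ℤ)) ≤ 3 * 3 ^ (2 * (m - 1)) * (3 : ℝ) ^ (-(m : ℤ)) := by gcongr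
      _ = (3 : ℝ) ^ (m - 1) := by
          rw [zpow_neg, zpow_natCast]
          have e : (3 : ℝ) * 3 ^ (2 * (m - 1)) = 3 ^ (m - 1) * 3 ^ m := by
            rw [← pow_succ', ← pow_add]; congr 1; omega
          rw [e]; field_simp
      _ < 3 ^ m := hlt
  have hkey := norm_eq_norm_volkenbornSum_of_lipNatTwo (p := 3) (by norm_num) hM0 hM₂0 hF1' hF2' hI hbig
  rw [hSm, norm_mul, norm_inv] at hkey
  have hc : ‖cstB n‖ ≠ 0 := norm_ne_zero_iff.2 (cstB_ne_zero n)
  field_simp at hkey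
  linarith [hkey]

/-- **`T_n ≠ 0`** along `n = 3^m − 1`, `m ≥ 1` (Lai's «In particular `d_n^{2s+3}T_n ≠ 0`» at `p = 3`).
[cite: Lai2025TwoAdicZeta, Lemma 6.3 ("In particular, d_n^{2s+3}T_n ≠ 0") — transposed to p = 3] -/
theorem T_pow_three_sub_one_ne_zero {m : ℕ} (hm : 1 ≤ m) : T (3 ^ m - 1) ≠ 0 := by
  intro h
  have h1 := norm_T_pow_three_sub_one hm
  rw [h, norm_zero] at h1
  have h2 : 0 < ‖cstB (3 ^ m - 1)‖ * (3 : ℝ) ^ m := mul_pos (norm_pos_iff.2 (cstB_ne_zero _)) (by positivity)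
  linarith

/-- **Legendre at `p = 3`: `‖n!‖₃² ≤ 3^{2m − n}` for `n < 3^m`** (`2v₃(n!) = n − s₃(n) ≥ n − 2m`, since `n` has at most
`m` ternary digits, each `≤ 2`). [cite: Lai2025TwoAdicZeta, Lemma 6.3 (proof: "v₂((2^m−1)!) = n − m") — transposed to p = 3] -/
theorem norm_factorial_sq_le {n m : ℕ} (hnm : n < 3 ^ m) :
    ‖((n ! : ℕ) : ℚ_[3])‖ ^ 2 ≤ (3 : ℝ) ^ (2 * (m : ℤ) - n) := by
  haveI := Fact.mk Nat.prime_three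
  have hf0 : ((n ! : ℕ) : ℚ_[3]) ≠ 0 := by exact_mod_cast Nat.factorial_ne_zero n
  -- `‖n!‖₃ = 3^{−v₃(n!)}`
  have hnorm : ‖((n ! : ℕ) : ℚ_[3])‖ = (3 : ℝ) ^ (-(padicValNat 3 n ! : ℤ)) := by
    rw [Padic.norm_eq_zpow_neg_valuation hf0, Padic.valuation_natCast]
    norm_cast
  -- Legendre: `2·v₃(n!) = n − s₃(n)` and `s₃(n) ≤ 2m`
  have hleg : (3 - 1) * padicValNat 3 n ! = n - (Nat.digits 3 n).sum := sub_one_mul_padicValNat_factorial n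
  have hs_le : (Nat.digits 3 n).sum ≤ n := Nat.digit_sum_le 3 n
  have hdig : (Nat.digits 3 n).sum ≤ 2 * m := by
    have hlen : (Nat.digits 3 n).length ≤ m := (Nat.digits_length_le_iff (by norm_num) n).2 hnm
    have hle : ∀ d ∈ Nat.digits 3 n, d ≤ 2 := fun d hd => by
      have := Nat.digits_lt_base (by norm_num : 1 < 3) hd; omega
    calc (Nat.digits 3 n).sum ≤ (Nat.digits 3 n).length * 2 := by
          simpa using List.sum_le_card_nsmul _ 2 hle
      _ ≤ 2 * m := by omega
  have hv : (n : ℤ) - 2 * m ≤ 2 * (padicValNat 3 n ! : ℤ) := by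
    have h1 : 2 * padicValNat 3 n ! + (Nat.digits 3 n).sum = n := by omega
    have h2 : (2 : ℤ) * (padicValNat 3 n ! : ℤ) + ((Nat.digits 3 n).sum : ℤ) = n := by exact_mod_cast h1
    have h3 : ((Nat.digits 3 n).sum : ℤ) ≤ 2 * m := by exact_mod_cast hdig
    linarith
  rw [hnorm, ← zpow_natCast, ← zpow_mul]
  refine zpow_le_zpow_right₀ (by norm_num) ?_
  simp only [Nat.cast_ofNat]
  linarith

/-- `‖cstB n‖₃ = 3^{−(2(n+⌊n/2⌋)+2n+2)}·‖n!‖₃²`. [cite: Lai2025TwoAdicZeta, Lemma 6.3 (proof: v₂ of the prefactor) — transposed to p = 3] -/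
theorem norm_cstB (n : ℕ) :
    ‖cstB n‖ = (3 : ℝ) ^ (-((2 * (n + n / 2) + (2 * n + 2) : ℕ) : ℤ)) * ‖((n ! : ℕ) : ℚ_[3])‖ ^ 2 := by
  rw [cstB, norm_mul, norm_pow, norm_pow, norm_three, zpow_neg, zpow_natCast, inv_pow]

/-- **The `3`-adic smallness of the linear forms** along `n = 3^m − 1` (`m ≥ 1`):
`‖T_n‖₃ ≤ 3^{3m − 5n − 2⌊n/2⌋ − 2}`. [cite: Lai2025TwoAdicZeta, Lemma 6.3 ("|d_n^{2s+3}T_n|_2 = 2^{(−6s−12+o(1))n}") — transposed to p = 3] -/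
theorem norm_T_pow_three_sub_one_le {m : ℕ} (hm : 1 ≤ m) :
    ‖T (3 ^ m - 1)‖ ≤ (3 : ℝ) ^ (3 * (m : ℤ) - 5 * ((3 ^ m - 1 : ℕ) : ℤ) - 2 * (((3 ^ m - 1) / 2 : ℕ) : ℤ) - 2) := by
  set n : ℕ := 3 ^ m - 1 with hn
  have h3m : 1 ≤ 3 ^ m := Nat.one_le_pow _ _ (by norm_num)
  have hf := norm_factorial_sq_le (n := n) (m := m) (by omega)
  rw [norm_T_pow_three_sub_one hm, norm_cstB]
  calc (3 : ℝ) ^ (-((2 * (n + n / 2) + (2 * n + 2) : ℕ) : ℤ)) * ‖((n ! : ℕ) : ℚ_[3])‖ ^ 2 * 3 ^ m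
      ≤ (3 : ℝ) ^ (-((2 * (n + n / 2) + (2 * n + 2) : ℕ) : ℤ)) * (3 : ℝ) ^ (2 * (m : ℤ) - n) * 3 ^ m := by gcongr
    _ = (3 : ℝ) ^ (3 * (m : ℤ) - 5 * (n : ℤ) - 2 * ((n / 2 : ℕ) : ℤ) - 2) := by
        rw [← zpow_natCast (3 : ℝ) m, ← zpow_add₀ (by norm_num), ← zpow_add₀ (by norm_num)]
        congr 1
        push_cast
        ring

end Literature.NumberTheory.Irrationality.Calegari2005ThreeAdic
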